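/-
Copyright: harness cell b2b-lgcu-borel (gen 16).  Honest framing: the VALUE here is a THEOREM
conditional on the named classical hypothesis `DicksonList` (plus two unconditional numeric
lemmas) — NOT summit progress; the crux item `SubgroupIdentityDesigns`
(stmt-MatrixMultiplication-14079) stays open and untouched.
-/
import Mathlib
import Summits.MatrixMultiplication.MatrixMultiplication.Theorems.SubgroupIdentityDesigns.Negative.CellTwoOneStatus

/-!
# The candidate primes of the `(2,1)` cell, mod Dickson: `p = 61` or `p ≥ 157`

Route `LevelGradedCohnUmans`, crux `SubgroupIdentityDesigns`, negative side, cell `(m,k) = (2,1)`.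
`CellTwoOneStatus.witness_status_of_dicksonList_of_fortyseven_le` confines every level-one
witness at a prime `p ≥ 47` (mod Dickson, `0 < ε ≤ 1`) to `p ≥ 61`, `p ≡ 1 (mod 4)`,
`ω(p-1) ≥ 3`, `ε > 233/236`.  This file sharpens the list of candidate primes:

* `card_primeFactors_le_two_of_lt` (plain arithmetic): every prime `61 < q < 157` with
  `q ≡ 1 (mod 4)` has `ω(q-1) ≤ 2` (`q ∈ {73, 89, 97, 101, 109, 113, 137, 149}`,
  `q - 1 = 2³3², 2³11, 2⁵3, 2²5², 2²3³, 2⁴7, 2³17, 2²37`); so between `61` and `157` there is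
  no candidate at all;
* `five_le_log`, `log_bound_of_le` (unconditional numerics): `log 156 ≥ 5`, hence for
  `p ≥ 157` and `ε ≤ 772/775` the log-form gap hypothesis `3/(1-ε) ≤ (p-2) log(p-1)` holds;
* **`no_levelOne_witness_of_dicksonList_of_ne`** (mod Dickson): for every prime `p ≥ 47` with
  `p ≠ 61` and every `0 < ε ≤ 772/775 ≈ 0.99613` the `(2,1)` cell is EMPTY;
* **`witness_status_sharp_of_dicksonList`** (mod Dickson, `0 < ε ≤ 1`, `p ≥ 47`): a witness
  lives either at `p = 61` with `ε > 233/236`, or at a prime `p ≥ 157` with `p ≡ 1 (mod 4)`,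
  `ω(p-1) ≥ 3`, `ε > 772/775` (and `p < 2 + 3/(4(1-ε))` when `ε < 1`).

DATA complement (not a theorem; ORACLE-g16 §G16-4): at `p = 61` an exhaustive orbit-certificate
census (job j126920) found NO level-one identity design on any subgroup-TPP triple of the family-I
profile, so in practice the residual starts at `p = 157` and `ε > 772/775`.
Scope, honestly: conditional on `DicksonList`; primes `p ≤ 43` not covered; decides nothing about
design existence at `p ≥ 157`; VALUE = THEOREM, NOT summit progress; the crux item is untouched
and remains open.  Report: `run/shared/lean/b2b/levelgraded-cu/ORACLE-g16.md` §G16-1/6.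
-/

set_option linter.dupNamespace false

noncomputable section

open scoped Classical
open Summit.MatrixMultiplication.MatrixMultiplication.Theorems.LieRankDesigns.Negative (GLm Mat budget)
open Literature.Barriers.MatrixMultiplication (SubgroupTPP)

namespace Summit.MatrixMultiplication.MatrixMultiplication.Theorems.SubgroupIdentityDesigns.Negative

section CandidatePrimes

variable {p : ℕ} [hp : Fact p.Prime]

omit hp in
/-- The primes `61 < q < 157` with `q ≡ 1 (mod 4)`. -/
theorem eq_of_prime_of_lt_onefiftyseven {q : ℕ} (hq : q.Prime) (h61 : 61 < q) (h157 : q < 157)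
    (h4 : q % 4 = 1) :
    q = 73 ∨ q = 89 ∨ q = 97 ∨ q = 101 ∨ q = 109 ∨ q = 113 ∨ q = 137 ∨ q = 149 := by
  interval_cases q <;> first | omega | exact absurd hq (by norm_num)

omit hp in
/-- Every prime `61 < q < 157` with `q ≡ 1 (mod 4)` has `ω(q - 1) ≤ 2`. -/
theorem card_primeFactors_le_two_of_lt {q : ℕ} (hq : q.Prime) (h61 : 61 < q) (h157 : q < 157)
    (h4 : q % 4 = 1) : (q - 1).primeFactors.card ≤ 2 := by
  rcases eq_of_prime_of_lt_onefiftyseven hq h61 h157 h4 with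
    rfl | rfl | rfl | rfl | rfl | rfl | rfl | rfl
  · rw [show (73 : ℕ) - 1 = 2 ^ 3 * 3 ^ 2 from rfl]
    exact card_primeFactors_prime_pow_mul_prime_pow_le Nat.prime_two Nat.prime_three
  · rw [show (89 : ℕ) - 1 = 2 ^ 3 * 11 ^ 1 from rfl]
    exact card_primeFactors_prime_pow_mul_prime_pow_le Nat.prime_two (by norm_num)
  · rw [show (97 : ℕ) - 1 = 2 ^ 5 * 3 ^ 1 from rfl]
    exact card_primeFactors_prime_pow_mul_prime_pow_le Nat.prime_two Nat.prime_three
  · rw [show (101 : ℕ) - 1 = 2 ^ 2 * 5 ^ 2 from rfl]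
    exact card_primeFactors_prime_pow_mul_prime_pow_le Nat.prime_two Nat.prime_five
  · rw [show (109 : ℕ) - 1 = 2 ^ 2 * 3 ^ 3 from rfl]
    exact card_primeFactors_prime_pow_mul_prime_pow_le Nat.prime_two Nat.prime_three
  · rw [show (113 : ℕ) - 1 = 2 ^ 4 * 7 ^ 1 from rfl]
    exact card_primeFactors_prime_pow_mul_prime_pow_le Nat.prime_two (by norm_num)
  · rw [show (137 : ℕ) - 1 = 2 ^ 3 * 17 ^ 1 from rfl]
    exact card_primeFactors_prime_pow_mul_prime_pow_le Nat.prime_two (by norm_num)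
  · rw [show (149 : ℕ) - 1 = 2 ^ 2 * 37 ^ 1 from rfl]
    exact card_primeFactors_prime_pow_mul_prime_pow_le Nat.prime_two (by norm_num)

omit hp in
/-- `log 156 ≥ 5` (from `e < 2.7182818286`, so `e⁵ < 148.42 < 156`). -/
theorem five_le_log : (5 : ℝ) ≤ Real.log 156 := by
  rw [Real.le_log_iff_exp_le (by norm_num)]
  have h1 := Real.exp_one_lt_d9
  have h5 : Real.exp 5 = Real.exp 1 ^ 5 := by
    rw [← Real.exp_nat_mul]; norm_num
  rw [h5]
  have h0 : 0 ≤ Real.exp 1 := (Real.exp_pos 1).le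
  calc Real.exp 1 ^ 5 ≤ (2.7182818286 : ℝ) ^ 5 := pow_le_pow_left₀ h0 h1.le 5
    _ ≤ 156 := by norm_num

omit hp in
/-- For `p ≥ 157` and `ε ≤ 772/775` the log-form gap hypothesis holds:
`3/(1-ε) ≤ 775 = 155 · 5 ≤ (p-2) log(p-1)`. -/
theorem log_bound_of_le (hp157 : 157 ≤ p) {ε : ℝ} (hε1 : ε ≤ 772 / 775) :
    3 / (1 - ε) ≤ ((p : ℝ) - 2) * Real.log ((p : ℝ) - 1) := by
  have hp' : (157 : ℝ) ≤ p := by exact_mod_cast hp157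
  have hlog : (5 : ℝ) ≤ Real.log ((p : ℝ) - 1) :=
    five_le_log.trans (Real.log_le_log (by norm_num) (by linarith))
  have h1 : 3 / (1 - ε) ≤ 775 := by
    rw [div_le_iff₀ (by linarith)]; linarith
  calc 3 / (1 - ε) ≤ 775 := h1
    _ ≤ ((p : ℝ) - 2) * 5 := by linarith
    _ ≤ ((p : ℝ) - 2) * Real.log ((p : ℝ) - 1) :=
        mul_le_mul_of_nonneg_left hlog (by linarith)

/-- **EMPTY for `ε ≤ 772/775` at every prime `p ≥ 47` other than `61`, mod Dickson**: between
`61` and `157` no prime has `p ≡ 1 (mod 4)` and `ω(p-1) ≥ 3`, and from `157` on the log-form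
family-I gap applies. -/
theorem no_levelOne_witness_of_dicksonList_of_ne (hp47 : 47 ≤ p) (h61 : p ≠ 61) {n : ZMod p}
    (hn : ∀ x : ZMod p, x * x ≠ n) (hD : DicksonList p n)
    {ε : ℝ} (hε : 0 < ε) (hε1 : ε ≤ 772 / 775)
    {H₁ H₂ H₃ : Subgroup (GLm p 2)} (htpp : SubgroupTPP H₁ H₂ H₃)
    (hdesign : ∃ c : Mat p 2 → ℂ, (∀ M, 1 < M.rank → c M = 0) ∧
      (∑ M, c M * ZMod.stdAddChar (Matrix.trace (M * ((1 : GLm p 2) : Mat p 2)))) = 1 ∧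
      ∀ a ∈ H₁, ∀ b ∈ H₂, ∀ g ∈ H₃, a * b * g ≠ 1 →
        (∑ M, c M *
          ZMod.stdAddChar (Matrix.trace (M * ((a * b * g : GLm p 2) : Mat p 2)))) = 0) :
    ¬ budget p 2 1 (2 + ε) <
      ((Nat.card H₁ * Nat.card H₂ * Nat.card H₃ : ℕ) : ℝ) ^ ((2 + ε) / 3) := by
  intro hwit
  obtain ⟨h61le, h4, hω, -, -⟩ :=
    witness_status_of_dicksonList_of_fortyseven_le hp47 hn hD hε (by linarith) htpp hdesign hwit
  by_cases h157 : 157 ≤ p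
  · exact no_levelOne_witness_of_dicksonList_log (by omega) hn hD hε (by linarith)
      (log_bound_of_le h157 hε1) htpp hdesign hwit
  · have h2 := card_primeFactors_le_two_of_lt hp.out (by omega) (by omega) h4
    omega

/-- **THE CANDIDATE PRIMES, mod Dickson** (`0 < ε ≤ 1`, `p ≥ 47`): a subgroup-TPP triple with a
level-one identity design satisfying the level-one crux inequality lives either at `p = 61` with
`ε > 233/236`, or at a prime `p ≥ 157` with `p ≡ 1 (mod 4)`, `ω(p-1) ≥ 3`, `ε > 772/775`, and
`p < 2 + 3/(4(1-ε))` when `ε < 1`.  (DATA, not part of the theorem: `p = 61` carries no design by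
the exhaustive census j126920.)  Conditional on `DicksonList`; VALUE = THEOREM, NOT summit
progress. -/
theorem witness_status_sharp_of_dicksonList (hp47 : 47 ≤ p) {n : ZMod p}
    (hn : ∀ x : ZMod p, x * x ≠ n) (hD : DicksonList p n)
    {ε : ℝ} (hε : 0 < ε) (hε1 : ε ≤ 1)
    {H₁ H₂ H₃ : Subgroup (GLm p 2)} (htpp : SubgroupTPP H₁ H₂ H₃)
    (hdesign : ∃ c : Mat p 2 → ℂ, (∀ M, 1 < M.rank → c M = 0) ∧
      (∑ M, c M * ZMod.stdAddChar (Matrix.trace (M * ((1 : GLm p 2) : Mat p 2)))) = 1 ∧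
      ∀ a ∈ H₁, ∀ b ∈ H₂, ∀ g ∈ H₃, a * b * g ≠ 1 →
        (∑ M, c M *
          ZMod.stdAddChar (Matrix.trace (M * ((a * b * g : GLm p 2) : Mat p 2)))) = 0)
    (hwit : budget p 2 1 (2 + ε) <
      ((Nat.card H₁ * Nat.card H₂ * Nat.card H₃ : ℕ) : ℝ) ^ ((2 + ε) / 3)) :
    (p = 61 ∧ (233 : ℝ) / 236 < ε) ∨
    (157 ≤ p ∧ p % 4 = 1 ∧ 3 ≤ (p - 1).primeFactors.card ∧ (772 : ℝ) / 775 < ε ∧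
      (ε < 1 → (p : ℝ) < 2 + 3 / (4 * (1 - ε)))) := by
  obtain ⟨h61le, h4, hω, h236, hbd⟩ :=
    witness_status_of_dicksonList_of_fortyseven_le hp47 hn hD hε hε1 htpp hdesign hwit
  by_cases h61 : p = 61
  · exact Or.inl ⟨h61, h236⟩
  refine Or.inr ⟨?_, h4, hω, ?_, hbd⟩
  · by_contra h157
    have h2 := card_primeFactors_le_two_of_lt hp.out (by omega) (by omega) h4
    omega
  · by_contra hle
    exact no_levelOne_witness_of_dicksonList_of_ne hp47 h61 hn hD hε (not_lt.mp hle) htpp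
      hdesign hwit

end CandidatePrimes

end Summit.MatrixMultiplication.MatrixMultiplication.Theorems.SubgroupIdentityDesigns.Negative

end
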